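import Summits.Ventures.PackingBounds.ThreePointCert.K7d12Agg1
import Summits.Ventures.PackingBounds.ThreePointCert.CheckFastFZ

/-!
# κ(7) ≤ 134: kernel validation of the blocks of (i') and of the `FI` expansion (Gram form, `ThreePointCert.CheckFastF`, trie-free check `CheckFastFZ`)

Framing: lottery ticket; floor = certified bounds/negative ranges. Venture `PackingBounds` (cell
`pub-packcert`), three-point SDP family. Integer data of a feasible point of the Bachoc–Vallentin
semidefinite program (n = 7, s = 1/2, degree d = 12, symmetric
sums of squares), derived by `pub-packcert-lp/code/lean3pt/cert2lean_lp.py` from the exact rational certificate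
`sdp-d7-deg12-sym-lp-v1.json` of the cell (exact verifier #1 + verifier #2 of the other seat), in the units of the kernel
checker `ThreePointCert.Check` (soundness `ThreePointCert.Sound`/`Soundness`); Gram factors offset-encoded for the
Kronecker-packed chunk validation `ThreePointCert.CheckKron` (emitter `emitleanK.py`, lp gen 3). Generated file: plain
lists of integers / monomials. Part 2 of 3.
-/

namespace Summit.Ventures.PackingBounds.ThreePointCert.K7d12

open Literature.Geometry.DiscreteGeometry Literature.Geometry.DiscreteGeometry.PolyCert PolyCert.SPoly

set_option maxRecDepth 100000 in
set_option maxHeartbeats 0 in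
/-- `FI` expansion, blocks [4] (kernel, Gram form + sorted-merge zero test, `CheckFastF`/`CheckFastFZ`). -/
theorem okF_5 : FchunkOKZ K7d12.cert.n K7d12.cert.d [FBlk.mk 4 K7d12.fw4] K7d12.dFc4 K7d12.dFc5 = true := by
  decide +kernel

set_option maxRecDepth 100000 in
set_option maxHeartbeats 0 in
/-- `FI` expansion, blocks [5] (kernel, Gram form + sorted-merge zero test, `CheckFastF`/`CheckFastFZ`). -/
theorem okF_6 : FchunkOKZ K7d12.cert.n K7d12.cert.d [FBlk.mk 5 K7d12.fw5] K7d12.dFc5 K7d12.dFc6 = true := by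
  decide +kernel

set_option maxRecDepth 100000 in
set_option maxHeartbeats 0 in
/-- `FI` expansion, blocks [6] (kernel, Gram form + sorted-merge zero test, `CheckFastF`/`CheckFastFZ`). -/
theorem okF_7 : FchunkOKZ K7d12.cert.n K7d12.cert.d [FBlk.mk 6 K7d12.fw6] K7d12.dFc6 K7d12.dFc7 = true := by
  decide +kernel

set_option maxRecDepth 100000 in
set_option maxHeartbeats 0 in
/-- `FI` expansion, blocks [7] (kernel, Gram form + sorted-merge zero test, `CheckFastF`/`CheckFastFZ`). -/
theorem okF_8 : FchunkOKZ K7d12.cert.n K7d12.cert.d [FBlk.mk 7 K7d12.fw7] K7d12.dFc7 K7d12.dFc8 = true := by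
  decide +kernel


end Summit.Ventures.PackingBounds.ThreePointCert.K7d12
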